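import Mathlib
import Summits.ResolutionOfSingularities.ResolutionOfSingularities.Theorems.WildQuotientsWildQuotientResolutionJordanFourTwistedChart

/-!
# R-T rung (J₅) — definitions of record for the UNIVERSAL TWISTED ROOT CHART at the `μ₃`-vertex (`x₁`) of `Bl_w 𝔸ⁿ`, `w = (4,3,2,1,0)`

(crux stmt-ResolutionOfSingularities-15640 `WildQuotients.WildQuotientResolution`, line `Sketch`,
sector `|G| = p`; programme «R-T twisted root charts in general» of `L/w45c/CHAIN.md` v7.9 §5
(NEXT, research rung beyond W4.5c), design memo `L/res-L1-w45c-idea-2/RT-J5.md` §1/§4 (ideator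
res-L1-w45c-idea-2, kit j268814/j269110/j269238; identities re-derived in kit j275294 by this seat)
and `RT-LADDER.md` §7 item 4 («`JordanFive.SliceX1`»). [OURS · L1 W4.5c] — NOT a statement of any
manuscript (Hironaka 2017 is consumed nowhere); replaces the role of no printed item. Owner
res-L1-w45c-stub-1 (CHAIN v7 DEF OWNERSHIP: the `twistedChart` family). AI-written Lean,
kernel-checked; weaker than expert review.)

Set-up: `k` a field with `2, 3 ∈ kˣ` (characteristic `p ≥ 5`), indices `a b c d e : Fin n` carrying
the Jordan block `J₅` (`σ x_a = x_a`, `σ x_b = x_b + x_a`, `σ x_c = x_c + x_b`, `σ x_d = x_d + x_c`,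
`σ x_e = x_e + x_d`, passengers fixed). SLOTS OF RECORD for the chart variables of the `μ₃`-vertex
(the `x_b`-vertex, weight `3`, of the `(4,3,2,1)`-weighted blow-up of the fixed locus):
`l ↔ X b` (the twisted cube root, `l³ = T'/H'`), `A ↔ X a` (`= x_a/l⁴`), `ξ ↔ X c` (the slice
`lM/H'`), `η₁ ↔ X d` (`= Δ₇/(l H'³)`), `η₂ ↔ X e` (the new integration constant), passengers
`X i ↔ X i`. The chart is the `k`-algebra endomorphism `ψ₅ = twistedChart k n a b c d e` of
`k[x₁,…,xₙ]` with (RT-J5 §4, the `F`-recursion of §1 (C))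
* `ψ₅(x_a) = l⁴A`,
* `ψ₅(x_b) = l³(1 + Aξ)`,
* `ψ₅(x_c) = l²·P`, `P = ξ + l + (A/2)(ξ² − lξ − η₁)` — LITERALLY `JordanFour.twistedP k n a b c d`,
* `ψ₅(x_d) = (l/6)·D`, `D = twistedD = 3ξ² + 3lξ − η₁ + 2l² + A(ξ³ − 3lξ² − 3ξη₁ + 2l²ξ)` — the
  cleared form of record of `6·ψ₄(x_d)` (`JordanFour.six_mul_twistedChart_X_d`),
* `ψ₅(x_e) = (1/24)·E`, `E = twistedE = 4ξ³ + 4l²ξ − 4η₁ξ + 24η₂ + A(ξ⁴ − 6lξ³ + 11l²ξ² − 6l³ξ −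
  6η₁ξ² + 6lη₁ξ)`,
* `ψ₅(x_i) = x_i` otherwise.
So `ψ₅` restricted to `x_a, x_b, x_c, x_d` is `l · ψ₄` (the J₄ chart of `…JordanFourTwistedChartDefs`
with `s ↦ l`, `η ↦ η₁`): `twistedChart_X_a/b/c/d_eq_X_b_mul`. The J₄ invariants
`H' = JordanFour.hPrime`, `T' = tPrime`, `M = mSlice`, `Δ₇ = delta7` (they involve `x_a … x_d` only
and are `σ`-invariant for every `J_n`, `n ≥ 4`) keep their names; NEW at `n = 5` are the quadratic
and cubic invariants `i₂ = iTwo`, `2j₃ = jThreeTwo` (RT-J5 §2, denominators cleared) tied by the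
degree-`6` syzygy `T'² − H'³ − 3x_aT'H' + 2x_a²H'² + 3x_a²H'i₂ + x_a³(2j₃) = 0` (`syzygy_six`).
The laws (T5-i equivariance `ψ₅ ∘ σ = Σ_l ∘ ψ₅`, T5-iii values of `H', T', M, Δ₇, i₂, 2j₃` on the
chart) are proved in `…JordanFiveTwistedChart.lean`; this file fixes the objects, their evaluation
on variables, the cleared forms and the link to the J₄ chart.
-/

-- single-problem summit: the doubled namespace component `ResolutionOfSingularities` is forced
set_option linter.dupNamespace false

noncomputable section

open MvPolynomial

namespace Summit.ResolutionOfSingularities.ResolutionOfSingularities.Theorems.WildQuotientResolution.JordanFive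

section Defs

variable (k : Type) [Field k] (n : ℕ) (a b c d e : Fin n)

/-- `D = 3ξ² + 3lξ − η₁ + 2l² + A(ξ³ − 3lξ² − 3ξη₁ + 2l²ξ)` (slots `l = X b`, `A = X a`, `ξ = X c`,
`η₁ = X d`): the cleared numerator with `ψ₅(x_d) = (l/6)·D`; literally the right-hand side of
`JordanFour.six_mul_twistedChart_X_d`. [OURS · L1 W4.5c] -/
def twistedD : MvPolynomial (Fin n) k :=
  3 * X c ^ 2 + 3 * (X b * X c) - X d + 2 * X b ^ 2 +
    X a * (X c ^ 3 - 3 * (X b * X c ^ 2) - 3 * (X c * X d) + 2 * (X b ^ 2 * X c))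

/-- `E = 4ξ³ + 4l²ξ − 4η₁ξ + 24η₂ + A(ξ⁴ − 6lξ³ + 11l²ξ² − 6l³ξ − 6η₁ξ² + 6lη₁ξ)` (slots `l = X b`,
`A = X a`, `ξ = X c`, `η₁ = X d`, `η₂ = X e`): the cleared numerator with `ψ₅(x_e) = E/24`
(RT-J5 §4). [OURS · L1 W4.5c] -/
def twistedE : MvPolynomial (Fin n) k :=
  4 * X c ^ 3 + 4 * (X b ^ 2 * X c) - 4 * (X d * X c) + 24 * X e +
    X a * (X c ^ 4 - 6 * (X b * X c ^ 3) + 11 * (X b ^ 2 * X c ^ 2) - 6 * (X b ^ 3 * X c) -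
      6 * (X d * X c ^ 2) + 6 * (X b * X d * X c))

/-- The images of the variables under the J₅ twisted chart `ψ₅` (RT-J5 §4, formulas of record).
[OURS · L1 W4.5c] -/
def twistedChartFun : Fin n → MvPolynomial (Fin n) k := fun i =>
  if i = a then X b ^ 4 * X a
  else if i = b then X b ^ 3 * (1 + X a * X c)
  else if i = c then X b ^ 2 * JordanFour.twistedP k n a b c d
  else if i = d then C (6⁻¹ : k) * (X b * twistedD k n a b c d)
  else if i = e then C (24⁻¹ : k) * twistedE k n a b c d e
  else X i

/-- **The universal twisted root chart `ψ₅ : k[x] → k[l, A, ξ, η₁, η₂, passengers]`** at the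
`μ₃`-vertex of the `(4,3,2,1)`-weighted blow-up for `J₅` (as an endomorphism of `k[x₁,…,xₙ]`,
slots `l = X b`, `A = X a`, `ξ = X c`, `η₁ = X d`, `η₂ = X e`). [OURS · L1 W4.5c] -/
def twistedChart : MvPolynomial (Fin n) k →ₐ[k] MvPolynomial (Fin n) k :=
  aeval (twistedChartFun k n a b c d e)

/-- `i₂ = x_c² − x_bx_c − 2x_bx_d + x_ax_c + 3x_ax_d + 2x_ax_e` — the quadratic `σ`-invariant of
`J₅` that is new with respect to `J₄` (RT-J5 §2; `(4,3,2,1,0)`-weight `4`, initial form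
`x_c² − 2x_bx_d + 2x_ax_e`). [OURS · L1 W4.5c] -/
def iTwo : MvPolynomial (Fin n) k :=
  X c ^ 2 - X b * X c - 2 * (X b * X d) + X a * X c + 3 * (X a * X d) + 2 * (X a * X e)

/-- `2j₃ = −2x_c³ + 3x_bx_c² + 6x_bx_cx_d − x_b²x_c − 6x_b²x_d − 6x_b²x_e + x_ax_bx_c + 6x_ax_bx_d +
6x_ax_bx_e − 2x_ax_c² + 12x_ax_cx_e − 9x_ax_d²` — twice the cubic `σ`-invariant `j₃` of `J₅`
(RT-J5 §2, denominators `2` cleared; weight `6`). [OURS · L1 W4.5c] -/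
def jThreeTwo : MvPolynomial (Fin n) k :=
  X a * X b * X c + 6 * (X a * X b * X d) + 6 * (X a * X b * X e) - 2 * (X a * X c ^ 2) +
    12 * (X a * X c * X e) - 9 * (X a * X d ^ 2) - X b ^ 2 * X c - 6 * (X b ^ 2 * X d) -
    6 * (X b ^ 2 * X e) + 3 * (X b * X c ^ 2) + 6 * (X b * X c * X d) - 2 * X c ^ 3

end Defs

section Simp

variable (k : Type) [Field k] (n : ℕ) (a b c d e : Fin n)

/-- `ψ₅(x_a) = l⁴A`. [folklore] -/
theorem twistedChart_X_a : twistedChart k n a b c d e (X a) = X b ^ 4 * X a := by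
  simp [twistedChart, twistedChartFun]

/-- `ψ₅(x_b) = l³(1 + Aξ)` (`a ≠ b`). [folklore] -/
theorem twistedChart_X_b (hab : a ≠ b) :
    twistedChart k n a b c d e (X b) = X b ^ 3 * (1 + X a * X c) := by
  simp [twistedChart, twistedChartFun, hab.symm]

/-- `ψ₅(x_c) = l²·P` with `P = JordanFour.twistedP` (`a ≠ c`, `b ≠ c`). [folklore] -/
theorem twistedChart_X_c (hac : a ≠ c) (hbc : b ≠ c) :
    twistedChart k n a b c d e (X c) = X b ^ 2 * JordanFour.twistedP k n a b c d := by
  simp [twistedChart, twistedChartFun, hac.symm, hbc.symm]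

/-- `ψ₅(x_d) = (1/6)·(l·D)` (`d ≠ a, b, c`). [folklore] -/
theorem twistedChart_X_d (had : a ≠ d) (hbd : b ≠ d) (hcd : c ≠ d) :
    twistedChart k n a b c d e (X d) = C (6⁻¹ : k) * (X b * twistedD k n a b c d) := by
  simp [twistedChart, twistedChartFun, had.symm, hbd.symm, hcd.symm]

/-- `ψ₅(x_e) = (1/24)·E` (`e ≠ a, b, c, d`). [folklore] -/
theorem twistedChart_X_e (hae : a ≠ e) (hbe : b ≠ e) (hce : c ≠ e) (hde : d ≠ e) :
    twistedChart k n a b c d e (X e) = C (24⁻¹ : k) * twistedE k n a b c d e := by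
  simp [twistedChart, twistedChartFun, hae.symm, hbe.symm, hce.symm, hde.symm]

/-- `ψ₅(x_i) = x_i` for a passenger `i ∉ {a, b, c, d, e}`. [folklore] -/
theorem twistedChart_X_of_ne (i : Fin n) (hia : i ≠ a) (hib : i ≠ b) (hic : i ≠ c) (hid : i ≠ d)
    (hie : i ≠ e) : twistedChart k n a b c d e (X i) = X i := by
  simp [twistedChart, twistedChartFun, hia, hib, hic, hid, hie]

/-- `ψ₅` fixes constants. [folklore] -/
theorem twistedChart_C (r : k) : twistedChart k n a b c d e (C r) = C r := by
  simp [twistedChart]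

end Simp

section Cleared

variable (k : Type) [Field k] (n : ℕ) (a b c d e : Fin n)
  (hab : a ≠ b) (hac : a ≠ c) (had : a ≠ d) (hae : a ≠ e) (hbc : b ≠ c) (hbd : b ≠ d) (hbe : b ≠ e)
  (hcd : c ≠ d) (hce : c ≠ e) (hde : d ≠ e)

/-- `24 ≠ 0` in `k` when `2, 3 ∈ kˣ`. [folklore] -/
theorem twentyFour_ne_zero (h2 : (2 : k) ≠ 0) (h3 : (3 : k) ≠ 0) : (24 : k) ≠ 0 := by
  rw [show (24 : k) = 2 * 2 * 2 * 3 by norm_num]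
  exact mul_ne_zero (mul_ne_zero (mul_ne_zero h2 h2) h2) h3

/-- `24 · C(24⁻¹) = 1` in `k[x]` (`2, 3 ∈ kˣ`). [folklore] -/
theorem twentyFour_mul_C_inv (h2 : (2 : k) ≠ 0) (h3 : (3 : k) ≠ 0) :
    (24 : MvPolynomial (Fin n) k) * C (24⁻¹ : k) = 1 := by
  rw [← map_ofNat C 24, ← map_mul, mul_inv_cancel₀ (twentyFour_ne_zero k h2 h3), map_one]

/-- `2 ≠ 0` in `k[x]` (`2 ∈ kˣ`). [folklore] -/
theorem two_ne_zero_poly (h2 : (2 : k) ≠ 0) : (2 : MvPolynomial (Fin n) k) ≠ 0 := by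
  intro h
  have h1 := JordanFour.two_mul_C_inv_two k n h2
  rw [h, zero_mul] at h1
  exact zero_ne_one h1

/-- `24 ≠ 0` in `k[x]` (`2, 3 ∈ kˣ`). [folklore] -/
theorem twentyFour_ne_zero_poly (h2 : (2 : k) ≠ 0) (h3 : (3 : k) ≠ 0) :
    (24 : MvPolynomial (Fin n) k) ≠ 0 := by
  intro h
  have h1 := twentyFour_mul_C_inv k n h2 h3
  rw [h, zero_mul] at h1
  exact zero_ne_one h1

include hac hbc in
/-- Cleared form `2·ψ₅(x_c) = l²·(2ξ + 2l + A(ξ² − lξ − η₁))`. [OURS · L1 W4.5c] -/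
theorem two_mul_twistedChart_X_c (h2 : (2 : k) ≠ 0) :
    2 * twistedChart k n a b c d e (X c) =
      X b ^ 2 * (2 * X c + 2 * X b + X a * (X c ^ 2 - X b * X c - X d)) := by
  rw [twistedChart_X_c k n a b c d e hac hbc, mul_left_comm, JordanFour.two_mul_twistedP k n a b c d h2]

include had hbd hcd in
/-- Cleared form `6·ψ₅(x_d) = l·D`. [OURS · L1 W4.5c] -/
theorem six_mul_twistedChart_X_d (h2 : (2 : k) ≠ 0) (h3 : (3 : k) ≠ 0) :
    6 * twistedChart k n a b c d e (X d) = X b * twistedD k n a b c d := by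
  rw [twistedChart_X_d k n a b c d e had hbd hcd]
  linear_combination (X b * twistedD k n a b c d) * JordanFour.six_mul_C_inv_six k n h2 h3

include hae hbe hce hde in
/-- Cleared form `24·ψ₅(x_e) = E`. [OURS · L1 W4.5c] -/
theorem twentyFour_mul_twistedChart_X_e (h2 : (2 : k) ≠ 0) (h3 : (3 : k) ≠ 0) :
    24 * twistedChart k n a b c d e (X e) = twistedE k n a b c d e := by
  rw [twistedChart_X_e k n a b c d e hae hbe hce hde]
  linear_combination (twistedE k n a b c d e) * twentyFour_mul_C_inv k n h2 h3

/-! ### `ψ₅ = l · ψ₄` on `x_a, x_b, x_c, x_d` (the J₄ chart of `…JordanFourTwistedChartDefs`, `s ↦ l`, `η ↦ η₁`) -/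

/-- `ψ₅(x_a) = l · ψ₄(x_a)`. [OURS · L1 W4.5c] -/
theorem twistedChart_X_a_eq_X_b_mul :
    twistedChart k n a b c d e (X a) = X b * JordanFour.twistedChart k n a b c d (X a) := by
  rw [twistedChart_X_a, JordanFour.twistedChart_X_a]
  ring

include hab in
/-- `ψ₅(x_b) = l · ψ₄(x_b)`. [OURS · L1 W4.5c] -/
theorem twistedChart_X_b_eq_X_b_mul :
    twistedChart k n a b c d e (X b) = X b * JordanFour.twistedChart k n a b c d (X b) := by
  rw [twistedChart_X_b k n a b c d e hab, JordanFour.twistedChart_X_b k n a b c d hab]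
  ring

include hac hbc in
/-- `ψ₅(x_c) = l · ψ₄(x_c)`. [OURS · L1 W4.5c] -/
theorem twistedChart_X_c_eq_X_b_mul :
    twistedChart k n a b c d e (X c) = X b * JordanFour.twistedChart k n a b c d (X c) := by
  rw [twistedChart_X_c k n a b c d e hac hbc, JordanFour.twistedChart_X_c k n a b c d hac hbc]
  ring

include had hbd hcd in
/-- `ψ₅(x_d) = l · ψ₄(x_d)` (`2, 3 ∈ kˣ`; via the two cleared forms). [OURS · L1 W4.5c] -/
theorem twistedChart_X_d_eq_X_b_mul (h2 : (2 : k) ≠ 0) (h3 : (3 : k) ≠ 0) :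
    twistedChart k n a b c d e (X d) = X b * JordanFour.twistedChart k n a b c d (X d) := by
  refine mul_left_cancel₀ (JordanFour.six_ne_zero' k n h2 h3) ?_
  rw [six_mul_twistedChart_X_d k n a b c d e had hbd hcd h2 h3, mul_left_comm,
    JordanFour.six_mul_twistedChart_X_d k n a b c d had hbd hcd h2 h3, twistedD]

end Cleared

end Summit.ResolutionOfSingularities.ResolutionOfSingularities.Theorems.WildQuotientResolution.JordanFive

end
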